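import Literature.MathematicalPhysics.QuantumLattice.PairFieldCommutatorLocalityTT
import HarnessLib

/-!
# Locality of the double commutator `[W, [H^{tt'}_L, W]]` for the translation sum `W` of ANY even local
# observable on the `t–t'` Hubbard torus

Topic `Literature/MathematicalPhysics/QuantumLattice`; generalisation of
`exists_norm_expect_doubleCommutator_pairField_le_TT'` (PairFieldCommutatorLocalityTT.lean: the case
`W = Δ_g + Δ_g†`) to an arbitrary even local observable `O ∈ 𝔄_{Λ_A}`. Everything is PROVED; no
definition, no named fact, no `sorry`.

* **`exists_norm_expect_doubleCommutator_sum_translate_le_TT'`** — for `O ∈ 𝔄_{Λ_A}` even there are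
  `C ≥ 0` and `L₀` with: for every side `L ≥ L₀` on which `Λ_A` fits into the torus, the translation sum
  `W = Σ_{v ∈ (ℤ/L)²} T_v Γ_L(O)` and `H = hubbardTorusTT' L t t' U` satisfy
  `‖⟨ψ, (W[H,W] − [H,W]W) ψ⟩‖ ≤ C·L²` uniformly in the unit vector `ψ`. Although `W` and `[H, W]` are each
  of norm `O(L²)`, their commutator is the translation sum of a LOCAL density (Bratteli–Robinson II §6.2.1):
  `[H^{tt'}_L, W]` is the translation sum of the embedded local commutator `[H^{tt'}_{Λ'}, Γ(incl) O]`,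
  `Λ' = thicken Λ_A 1` (`hubbardTorusTT'_commutator_sum_relabel_translate`), and the commutator of two
  translation sums is a translation sum (`expect_commutator_sum_relabel_translate`).

USE (crew hubbard-obs): this is the `O(L²)` constant `D` of the variational stationarity lemma
(`VariationalStationarity.lean`) for the Hermitian parts `B` of the translation sum of an
equation-of-motion word — the stationarity defect of a vector of excess `ε` is `≤ √(2εD) = O(L)`, i.e.
`O(1/L)` per site.

References: O. Bratteli, D. W. Robinson, *Operator Algebras and Quantum Statistical Mechanics 2* (1997),
§6.2.1 and Thm. 6.2.4 [BratteliRobinsonII1997]; T. Koma, H. Tasaki, J. Stat. Phys. 76 (1994) 745,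
Theorem 2.2 (2.9) (the bound `‖[[O,H],O]‖ ≤ 4r²h o² N`) [KomaTasaki1994].
-/

noncomputable section

namespace Literature.MathematicalPhysics.QuantumLattice

open Matrix Finset HubbardWave0 Literature.Probability.LatticeModels
open scoped ComplexOrder BigOperators

/-- **`‖⟨ψ, [W, [H^{tt'}_L, W]] ψ⟩‖ ≤ C·L²` for the translation sum `W = Σ_v T_v Γ_L(O)` of an even local
observable `O ∈ 𝔄_{Λ_A}`**, `H^{tt'}_L = hubbardTorusTT' L t t' U`, uniformly in the unit vector `ψ` and the
side `L ≥ L₀` (for every proof that `Λ_A` fits into the torus). Koma–Tasaki's `O(N)` bound on `[[O,H],O]`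
(Theorem 2.2 (2.9)) for a general even local density, via the translation-sum calculus of
Bratteli–Robinson II §6.2.1. [cite: KomaTasaki1994, Theorem 2.2 (2.9)] [cite: BratteliRobinsonII1997, §6.2.1] -/
theorem exists_norm_expect_doubleCommutator_sum_translate_le_TT' {ΛA : Finset (Site 2)}
    {Oloc : FermionOp ΛA} (hOeven : Oloc ∈ carEvenSubalgebra (Finset.univ : Finset (Orb (PolySite ΛA))))
    (t t' U : ℝ) :
    ∃ C : ℝ, ∃ L₀ : ℕ, 0 ≤ C ∧ ∀ (L : ℕ) [NeZero L], L₀ ≤ L →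
      ∀ (hA : Set.InjOn (Torus.proj (d := 2) L) ↑ΛA) (ψ : Fock (Orb (FermionTorus 2 L))), star ψ ⬝ᵥ ψ = 1 →
        ‖expect ((∑ v : TorusSite 2 L, relabel (Orb.translate v) (fermionEmbed (PolySite.toTorusEmb L hA) Oloc)) *
              (hubbardTorusTT' L t t' U *
                  (∑ v : TorusSite 2 L, relabel (Orb.translate v) (fermionEmbed (PolySite.toTorusEmb L hA) Oloc)) -
                (∑ v : TorusSite 2 L, relabel (Orb.translate v) (fermionEmbed (PolySite.toTorusEmb L hA) Oloc)) *
                  hubbardTorusTT' L t t' U) -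
            (hubbardTorusTT' L t t' U *
                  (∑ v : TorusSite 2 L, relabel (Orb.translate v) (fermionEmbed (PolySite.toTorusEmb L hA) Oloc)) -
                (∑ v : TorusSite 2 L, relabel (Orb.translate v) (fermionEmbed (PolySite.toTorusEmb L hA) Oloc)) *
                  hubbardTorusTT' L t t' U) *
              (∑ v : TorusSite 2 L, relabel (Orb.translate v) (fermionEmbed (PolySite.toTorusEmb L hA) Oloc)))
            ψ‖ ≤ C * (L : ℝ) ^ 2 := by
  -- regions and local data
  set Λ' : Finset (Site 2) := thicken ΛA 1 with hΛ'
  have hAΛ' : ΛA ⊆ Λ' := subset_thicken ΛA 1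
  have h8 : thicken ΛA 1 ⊆ Λ' := subset_of_eq rfl
  set Cloc : FermionOp Λ' := (hubbardTTPrimeFermionInteraction t t' U).localHamiltonian Λ' *
      fermionEmbed (PolySite.incl hAΛ') Oloc -
    fermionEmbed (PolySite.incl hAΛ') Oloc * (hubbardTTPrimeFermionInteraction t t' U).localHamiltonian Λ' with hCloc
  set Z : Finset (Site 2) := (Λ' ×ˢ ΛA).image (fun p => p.1 - p.2) with hZ
  set Ω : Finset (Site 2) := (ΛA ∪ Λ') ∪ Z.biUnion (fun z => shiftSet z ΛA) with hΩ
  have hAΩ : ΛA ⊆ Ω := Finset.subset_union_left.trans Finset.subset_union_left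
  have hC : Λ' ⊆ Ω := Finset.subset_union_right.trans Finset.subset_union_left
  have hZΩ : ∀ z ∈ Z, shiftSet z ΛA ⊆ Ω := fun z hz =>
    (Finset.subset_biUnion_of_mem (fun z => shiftSet z ΛA) hz).trans Finset.subset_union_right
  have hcomplete : ∀ a ∈ ΛA, ∀ c ∈ Λ', c - a ∈ Z := fun a ha c hc =>
    Finset.mem_image.2 ⟨(c, a), Finset.mem_product.2 ⟨hc, ha⟩, rfl⟩
  set D : FermionOp Ω := commDensity Ω Z hC Oloc Cloc with hDdef
  -- thresholds
  obtain ⟨L₁, hL₁⟩ := exists_forall_le_injOn_proj Ω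
  obtain ⟨L₂, hL₂⟩ := exists_forall_le_injOn_proj Z
  obtain ⟨L₃, hL₃⟩ := exists_forall_le_injOn_proj (thicken Λ' 1)
  refine ⟨∑ s, ∑ t, ‖D s t‖, max (max L₁ L₂) L₃,
    Finset.sum_nonneg fun s _ => Finset.sum_nonneg fun t _ => norm_nonneg _, fun L _ hL hA ψ hψ => ?_⟩
  have hΩinj : Set.InjOn (Torus.proj (d := 2) L) ↑Ω :=
    hL₁ L (le_trans (le_trans (le_max_left _ _) (le_max_left _ _)) hL)
  have hZinj : Set.InjOn (Torus.proj (d := 2) L) ↑Z :=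
    hL₂ L (le_trans (le_trans (le_max_right _ _) (le_max_left _ _)) hL)
  have hTinj : Set.InjOn (Torus.proj (d := 2) L) ↑(thicken Λ' 1) := hL₃ L (le_trans (le_max_right _ _) hL)
  -- `W` written with the embedding proofs of the two lemmas (proof irrelevance)
  set W := ∑ v : TorusSite 2 L, relabel (Orb.translate v) (fermionEmbed (PolySite.toTorusEmb L hA) Oloc) with hW
  have hW1 : W = ∑ v : TorusSite 2 L, relabel (Orb.translate v)
      (fermionEmbed (PolySite.toTorusEmb L (hΩinj.mono (Finset.coe_subset.2 hAΩ))) Oloc) := rfl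
  have hW2 : W = ∑ v : TorusSite 2 L, relabel (Orb.translate v)
      (fermionEmbed (PolySite.toTorusEmb L (hTinj.mono (by exact_mod_cast subset_thicken Λ' 1)))
        (fermionEmbed (PolySite.incl hAΛ') Oloc)) := by
    rw [hW]
    refine Finset.sum_congr rfl fun v _ => ?_
    rw [fermionEmbed_toTorusEmb_incl]
  -- `[H^{tt'}, W]` as a translation sum of `Γ_{Λ'} Cloc`
  have hHW : hubbardTorusTT' L t t' U * W - W * hubbardTorusTT' L t t' U =
      ∑ w : TorusSite 2 L, relabel (Orb.translate w)
        (fermionEmbed (PolySite.toTorusEmb L (hΩinj.mono (Finset.coe_subset.2 hC))) Cloc) := by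
    rw [hW2, hubbardTorusTT'_commutator_sum_relabel_translate L t t' U hAΛ' h8 hTinj Oloc]
  have key := expect_commutator_sum_relabel_translate L hΩinj hZinj hAΩ hC hZΩ hcomplete hOeven Cloc ψ
  rw [← hW1, ← hHW] at key
  change ‖expect (W * (hubbardTorusTT' L t t' U * W - W * hubbardTorusTT' L t t' U) -
      (hubbardTorusTT' L t t' U * W - W * hubbardTorusTT' L t t' U) * W) ψ‖ ≤ _
  rw [key, norm_mul, norm_pow, Complex.norm_natCast, mul_comm]
  exact mul_le_mul_of_nonneg_right (norm_torusAvgExpectAt_le_sum_norm L Ω D hψ) (by positivity)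

end Literature.MathematicalPhysics.QuantumLattice

end
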